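import Mathlib
import HarnessLib
import Summits.KontsevichZagierPeriods.Zeta5Search.Denom.LineProfileShape

/-!
# The D1 = L(1/3) tale-1 line profile and its shape at `ξ = 15/2` (D1 decay, one-variable side)

HONEST FRAMING: systematic search; no irrationality claim unless certified.  This file proves
elementary real-analysis facts about an explicit function of one variable; no statement about
`ζ(2)`, `ζ(5)` or any linear form is made here.  Cell pub-zeta5 (P1 g12, file T4 of fam-denom's
`families/denom/D1-DESIGN-NOTE.md`); it is the D1 twin of fam-denom's `Denom/RungALineProfileShape`.
D1 is the first-tale cone point `(19,16,13,22 | 0,3,6,38)` of [Zudilin2014ZetaTwo, §3] (fam-denom's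
RUNGD.md, L(1/3)).  Seen from `u = t − (16n+1) = (ξ − 16) n + iηn`, the rational function `R(t)` has the
numerator blocks `(0, 19n]`, `(3n, 16n]`, `(6n, 13n]` and the denominator block `(22n, 38n+1]`, so — with
the generic primitive `gPrim` of `Denom/LineProfile.lean` — its scaled line profile is
`profileD1 ξ η = profileD10 ξ η − 2π|η|`, `profileD10 ξ η = (gPrim η (ξ+3) − gPrim η (ξ−16))
+ (gPrim η ξ − gPrim η (ξ−13)) + (gPrim η (ξ−3) − gPrim η (ξ−10)) − (gPrim η (ξ+22) − gPrim η (ξ+6))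
+ profileD1Const`, `profileD1Const = 16 log 16 − 19 log 19 − 13 log 13 − 7 log 7 + 23`.  On the design
line `ξ = 15/2` (saddle `ξ* = 7.5010`, loss `4·10⁻⁷` nats; `HOME/code/p1/g12/tale1_profile.py`) put
`PD η = profileD1 (15/2) η` and `DD η = angleD1 (15/2) η − 2π` (`hasDerivAt_PD`).
* `DD_eq`: `DD = numLegsD − denAngleD − 2π`, six antitone legs `arctan (w/η)`,
  `w ∈ {21, 17, 15, 11, 9, 5}/2`, and `denAngleD η = arctan (59/(2η)) − arctan (27/(2η))
  = arctan (16η/(η² + 1593/4))` (`denAngleD_eq`), monotone on `(0, 19]` since `19² < 1593/4`.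
* `DD_antitoneOn` (`PD` concave on `(0, 19]`), `DD_neg_of_ge` and `DD_le_neg_four` (`DD ≤ −4`
  on `[19, ∞)`: `arctan x ≤ x`, `39/19 + 4 < 2π`), `PD_tail` (`PD η ≤ PD 19 − 4 (η − 19)`, `η ≥ 19`).
* `twoPointDD`: if `0 < η₁ ≤ η₂ ≤ 19`, `0 ≤ DD η₁`, `DD η₂ ≤ 0` then
  `PD η ≤ PD η₁ + DD η₁ (η₂ − η₁)` for all `η > 0`;  `PD_eq`: `PD` as eight signed values
  `gPrim η (p/10)` plus `profileD1Const − 2π|η|`.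
The numerical instance (`η₁ = 3.0785`, `η₂ = 3.0790`; design optimum `η* = 3.07875`,
`sup PD = −42.3343826`) is certified in `TwoTaleD1LineCertificate.lean`.
-/

noncomputable section

open Real Set

namespace Summit.KontsevichZagierPeriods.Zeta5Search.TwoTaleD1LineProfileShape

open Summit.KontsevichZagierPeriods.Zeta5Search.Denom.LineProfile
open Summit.KontsevichZagierPeriods.Zeta5Search.Denom.LineProfileShape (arctan_div_anti)

/-! ## The D1 profile (generic abscissa `ξ`) -/

/-- The factorial constant `16 log 16 − 19 log 19 − 13 log 13 − 7 log 7 + 23` of the D1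
profile. -/
def profileD1Const : ℝ :=
  16 * Real.log 16 - 19 * Real.log 19 - 13 * Real.log 13 - 7 * Real.log 7 + 23

/-- `profileD10 ξ η`: the `2π|η|`-free part of the D1 line profile at abscissa `ξ` —
numerator blocks `(ξ+3 | ξ−16)`, `(ξ | ξ−13)`, `(ξ−3 | ξ−10)`, denominator block `(ξ+22 | ξ+6)`,
and `profileD1Const`. -/
def profileD10 (ξ η : ℝ) : ℝ :=
  (gPrim η (ξ + 3) - gPrim η (ξ - 16)) + (gPrim η ξ - gPrim η (ξ - 13))
    + (gPrim η (ξ - 3) - gPrim η (ξ - 10)) - (gPrim η (ξ + 22) - gPrim η (ξ + 6)) + profileD1Const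

/-- The D1 line profile `profileD1 ξ η = profileD10 ξ η − 2π|η|`. -/
def profileD1 (ξ η : ℝ) : ℝ := profileD10 ξ η - 2 * Real.pi * |η|

/-- `angleD1 ξ η`: the `η`-derivative of `profileD10 ξ` (a signed sum of eight angles). -/
def angleD1 (ξ η : ℝ) : ℝ :=
  (Real.arctan ((ξ + 3) / η) - Real.arctan ((ξ - 16) / η))
    + (Real.arctan (ξ / η) - Real.arctan ((ξ - 13) / η))
    + (Real.arctan ((ξ - 3) / η) - Real.arctan ((ξ - 10) / η))
    - (Real.arctan ((ξ + 22) / η) - Real.arctan ((ξ + 6) / η))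

/-- `profileD10` is even in `η`. -/
theorem profileD10_neg_eta (ξ η : ℝ) : profileD10 ξ (-η) = profileD10 ξ η := by
  simp only [profileD10, gPrim_neg_eta]

/-- `profileD1` is even in `η`. -/
theorem profileD1_neg_eta (ξ η : ℝ) : profileD1 ξ (-η) = profileD1 ξ η := by
  simp only [profileD1, profileD10_neg_eta, abs_neg]

/-- `d/dη profileD10 ξ η = angleD1 ξ η` for `η ≠ 0`. -/
theorem hasDerivAt_profileD10_eta (ξ : ℝ) {η : ℝ} (hη : η ≠ 0) :
    HasDerivAt (fun η : ℝ => profileD10 ξ η) (angleD1 ξ η) η := by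
  have h := fun w => hasDerivAt_gPrim_eta hη w
  have key := (((((h (ξ + 3)).sub (h (ξ - 16))).add ((h ξ).sub (h (ξ - 13)))).add
    ((h (ξ - 3)).sub (h (ξ - 10)))).sub ((h (ξ + 22)).sub (h (ξ + 6)))).add_const profileD1Const
  exact key

/-- `d/dη profileD1 ξ η = angleD1 ξ η − 2π` for `η > 0`. -/
theorem hasDerivAt_profileD1_eta (ξ : ℝ) {η : ℝ} (hη : 0 < η) :
    HasDerivAt (fun η : ℝ => profileD1 ξ η) (angleD1 ξ η - 2 * Real.pi) η := by
  have habs : HasDerivAt (fun η : ℝ => 2 * Real.pi * |η|) (2 * Real.pi * 1) η := by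
    refine ((hasDerivAt_id' η).congr_of_eventuallyEq ?_).const_mul (2 * Real.pi)
    filter_upwards [Ioi_mem_nhds hη] with x hx using abs_of_pos hx
  have key : HasDerivAt (fun η : ℝ => profileD10 ξ η - 2 * Real.pi * |η|)
      (angleD1 ξ η - 2 * Real.pi * 1) η := (hasDerivAt_profileD10_eta ξ hη.ne').sub habs
  rw [mul_one] at key
  exact key

/-- `profileD1 ξ` is continuous on `(0, ∞)`. -/
theorem continuousOn_profileD1 (ξ : ℝ) : ContinuousOn (fun η : ℝ => profileD1 ξ η) (Ioi 0) :=
  fun _ hη => (hasDerivAt_profileD1_eta ξ hη).continuousAt.continuousWithinAt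

/-! ## The line `ξ = 15/2` -/

/-- `PD η = profileD1 (15/2) η`, the D1 line profile on the line `ξ = 15/2`. -/
def PD (η : ℝ) : ℝ := profileD1 (15 / 2) η

/-- `DD η = angleD1 (15/2) η − 2π` (the derivative of `PD` on `(0, ∞)`). -/
def DD (η : ℝ) : ℝ := angleD1 (15 / 2) η - 2 * Real.pi

/-- The six numerator legs `arctan (w/η)`, `w ∈ {105, 85, 75, 55, 45, 25}/10 = {21, 17, 15, 11, 9, 5}/2`. -/
def numLegsD (η : ℝ) : ℝ :=
  Real.arctan (105 / 10 / η) + Real.arctan (85 / 10 / η) + Real.arctan (75 / 10 / η)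
    + Real.arctan (55 / 10 / η) + Real.arctan (45 / 10 / η) + Real.arctan (25 / 10 / η)

/-- The denominator angle `arctan (295/(10η)) − arctan (135/(10η))`. -/
def denAngleD (η : ℝ) : ℝ := Real.arctan (295 / 10 / η) - Real.arctan (135 / 10 / η)

/-- `d/dη PD = DD` on `(0, ∞)`. -/
theorem hasDerivAt_PD {η : ℝ} (hη : 0 < η) : HasDerivAt PD (DD η) η :=
  hasDerivAt_profileD1_eta (15 / 2) hη

/-- `DD = numLegsD − denAngleD − 2π`. -/
theorem DD_eq (η : ℝ) : DD η = numLegsD η - denAngleD η - 2 * Real.pi := by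
  simp only [DD, angleD1, numLegsD, denAngleD]
  have e1 : ((15 : ℝ) / 2 + 3) / η = 105 / 10 / η := by ring
  have e2 : ((15 : ℝ) / 2 - 16) / η = -(85 / 10 / η) := by ring
  have e3 : ((15 : ℝ) / 2) / η = 75 / 10 / η := by ring
  have e4 : ((15 : ℝ) / 2 - 13) / η = -(55 / 10 / η) := by ring
  have e5 : ((15 : ℝ) / 2 - 3) / η = 45 / 10 / η := by ring
  have e6 : ((15 : ℝ) / 2 - 10) / η = -(25 / 10 / η) := by ring
  have e7 : ((15 : ℝ) / 2 + 22) / η = 295 / 10 / η := by ring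
  have e8 : ((15 : ℝ) / 2 + 6) / η = 135 / 10 / η := by ring
  rw [e1, e2, e3, e4, e5, e6, e7, e8, Real.arctan_neg, Real.arctan_neg, Real.arctan_neg]
  ring

/-- `PD = (eight signed values of gPrim at p/10) + profileD1Const − 2π|η|`. -/
theorem PD_eq (η : ℝ) : PD η =
    gPrim η (105 / 10) + gPrim η (85 / 10) + gPrim η (75 / 10) + gPrim η (55 / 10)
      + gPrim η (45 / 10) + gPrim η (25 / 10) - gPrim η (295 / 10) + gPrim η (135 / 10)
      + profileD1Const - 2 * Real.pi * |η| := by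
  simp only [PD, profileD1, profileD10]
  have e1 : gPrim η ((15 : ℝ) / 2 + 3) = gPrim η (105 / 10) := by norm_num
  have e2 : gPrim η ((15 : ℝ) / 2 - 16) = -gPrim η (85 / 10) := by
    rw [show ((15 : ℝ) / 2 - 16) = -(85 / 10) by norm_num, gPrim_neg]
  have e3 : gPrim η ((15 : ℝ) / 2) = gPrim η (75 / 10) := by norm_num
  have e4 : gPrim η ((15 : ℝ) / 2 - 13) = -gPrim η (55 / 10) := by
    rw [show ((15 : ℝ) / 2 - 13) = -(55 / 10) by norm_num, gPrim_neg]
  have e5 : gPrim η ((15 : ℝ) / 2 - 3) = gPrim η (45 / 10) := by norm_num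
  have e6 : gPrim η ((15 : ℝ) / 2 - 10) = -gPrim η (25 / 10) := by
    rw [show ((15 : ℝ) / 2 - 10) = -(25 / 10) by norm_num, gPrim_neg]
  have e7 : gPrim η ((15 : ℝ) / 2 + 22) = gPrim η (295 / 10) := by norm_num
  have e8 : gPrim η ((15 : ℝ) / 2 + 6) = gPrim η (135 / 10) := by norm_num
  rw [e1, e2, e3, e4, e5, e6, e7, e8]
  ring

/-- Closed form `denAngleD η = arctan (16η / (η² + 1593/4))` for `η > 0` (`Real.arctan_add`). -/
theorem denAngleD_eq {η : ℝ} (hη : 0 < η) :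
    denAngleD η = Real.arctan (16 * η / (η ^ 2 + 1593 / 4)) := by
  have hη' : η ≠ 0 := hη.ne'
  unfold denAngleD
  have hx : 0 < 295 / 10 / η := by positivity
  have hy : 0 < 135 / 10 / η := by positivity
  have h1 : (295 / 10 / η) * (-(135 / 10 / η)) < 1 := by nlinarith
  rw [sub_eq_add_neg, ← Real.arctan_neg, Real.arctan_add h1]
  congr 1
  have hD1 : (1 - 295 / 10 / η * -(135 / 10 / η)) ≠ 0 := by
    have : 0 < 1 - 295 / 10 / η * -(135 / 10 / η) := by nlinarith [mul_pos hx hy]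
    exact this.ne'
  have hD2 : η ^ 2 + 1593 / 4 ≠ 0 := by positivity
  rw [div_eq_div_iff hD1 hD2]
  field_simp
  ring

/-- `denAngleD` is monotone on `(0, 19]` (`19² = 361 < 1593/4`). -/
theorem denAngleD_mono {s t : ℝ} (hs : 0 < s) (hst : s ≤ t) (ht : t ≤ 19) :
    denAngleD s ≤ denAngleD t := by
  rw [denAngleD_eq hs, denAngleD_eq (hs.trans_le hst)]
  apply Real.arctan_mono
  rw [div_le_div_iff₀ (by positivity) (by positivity)]
  have hst' : s * t ≤ 19 * 19 := mul_le_mul (hst.trans ht) ht (hs.le.trans hst) (by norm_num)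
  nlinarith [mul_nonneg (sub_nonneg.2 hst) (by linarith : (0 : ℝ) ≤ 1593 / 4 - s * t)]

/-- `DD` is antitone on `(0, 19]`. -/
theorem DD_antitoneOn {s t : ℝ} (hs : 0 < s) (hst : s ≤ t) (ht : t ≤ 19) : DD t ≤ DD s := by
  rw [DD_eq, DD_eq]
  have hd := denAngleD_mono hs hst ht
  have l1 := arctan_div_anti (105 / 10) (by norm_num) hs hst
  have l2 := arctan_div_anti (85 / 10) (by norm_num) hs hst
  have l3 := arctan_div_anti (75 / 10) (by norm_num) hs hst
  have l4 := arctan_div_anti (55 / 10) (by norm_num) hs hst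
  have l5 := arctan_div_anti (45 / 10) (by norm_num) hs hst
  have l6 := arctan_div_anti (25 / 10) (by norm_num) hs hst
  unfold numLegsD
  linarith

/-- `DD η < 0` for `η ≥ 19` (`arctan x ≤ x`, `39/19 < 2π`). -/
theorem DD_neg_of_ge {η : ℝ} (hη : 19 ≤ η) : DD η < 0 := by
  rw [DD_eq]
  have hη0 : 0 < η := by linarith
  have hden : 0 ≤ denAngleD η := by
    unfold denAngleD
    have : Real.arctan (135 / 10 / η) ≤ Real.arctan (295 / 10 / η) :=
      Real.arctan_mono (div_le_div_of_nonneg_right (by norm_num) hη0.le)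
    linarith
  have leg : ∀ c : ℝ, 0 ≤ c → Real.arctan (c / η) ≤ c / 19 := fun c hc =>
    (show Real.arctan (c / η) ≤ c / η from by
      have ht : (0:ℝ) ≤ c / η := div_nonneg hc hη0.le
      have h0 : 0 ≤ Real.arctan (c / η) := by simpa using Real.arctan_mono ht
      have h := Real.le_tan h0 (Real.arctan_lt_pi_div_two _)
      rwa [Real.tan_arctan] at h).trans
      (div_le_div_of_nonneg_left hc (by norm_num) hη)
  have l1 := leg (105 / 10) (by norm_num)
  have l2 := leg (85 / 10) (by norm_num)
  have l3 := leg (75 / 10) (by norm_num)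
  have l4 := leg (55 / 10) (by norm_num)
  have l5 := leg (45 / 10) (by norm_num)
  have l6 := leg (25 / 10) (by norm_num)
  unfold numLegsD
  nlinarith [Real.pi_gt_three]

/-- `DD η ≤ −4` for `η ≥ 19` (`arctan x ≤ x`, `39/19 + 4 < 2π`). -/
theorem DD_le_neg_four {η : ℝ} (hη : 19 ≤ η) : DD η ≤ -4 := by
  rw [DD_eq]
  have hη0 : 0 < η := by linarith
  have hden : 0 ≤ denAngleD η := by
    unfold denAngleD
    have : Real.arctan (135 / 10 / η) ≤ Real.arctan (295 / 10 / η) :=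
      Real.arctan_mono (div_le_div_of_nonneg_right (by norm_num) hη0.le)
    linarith
  have leg : ∀ c : ℝ, 0 ≤ c → Real.arctan (c / η) ≤ c / 19 := fun c hc =>
    (show Real.arctan (c / η) ≤ c / η from by
      have ht : (0:ℝ) ≤ c / η := div_nonneg hc hη0.le
      have h0 : 0 ≤ Real.arctan (c / η) := by simpa using Real.arctan_mono ht
      have h := Real.le_tan h0 (Real.arctan_lt_pi_div_two _)
      rwa [Real.tan_arctan] at h).trans
      (div_le_div_of_nonneg_left hc (by norm_num) hη)
  have l1 := leg (105 / 10) (by norm_num)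
  have l2 := leg (85 / 10) (by norm_num)
  have l3 := leg (75 / 10) (by norm_num)
  have l4 := leg (55 / 10) (by norm_num)
  have l5 := leg (45 / 10) (by norm_num)
  have l6 := leg (25 / 10) (by norm_num)
  unfold numLegsD
  linarith [Real.pi_gt_d2]

/-- Tail slope: `PD η ≤ PD 19 − 4 (η − 19)` for `η ≥ 19` (mean value theorem and `DD_le_neg_four`). -/
theorem PD_tail {η : ℝ} (hη : 19 ≤ η) : PD η ≤ PD 19 - 4 * (η - 19) := by
  rcases hη.eq_or_lt with h | hlt
  · rw [← h]
    simp
  have cont : ContinuousOn PD (Icc 19 η) :=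
    (continuousOn_profileD1 (15 / 2)).mono fun x hx => lt_of_lt_of_le (by norm_num) hx.1
  have deriv : ∀ x ∈ Ioo 19 η, HasDerivAt PD (DD x) x := fun x hx =>
    hasDerivAt_PD (lt_trans (by norm_num) hx.1)
  obtain ⟨ξ, hξ, hslope⟩ := exists_hasDerivAt_eq_slope PD DD hlt cont deriv
  have h4 : DD ξ ≤ -4 := DD_le_neg_four hξ.1.le
  rw [hslope, div_le_iff₀ (by linarith)] at h4
  linarith

/-- **Two-point tangent lemma.**  If `0 < η₁ ≤ η₂ ≤ 19`, `0 ≤ DD η₁` and `DD η₂ ≤ 0`, then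
`PD η ≤ PD η₁ + DD η₁ · (η₂ − η₁)` for every `η > 0`. -/
theorem twoPointD {η₁ η₂ : ℝ} (h1 : 0 < η₁) (h12 : η₁ ≤ η₂) (h2 : η₂ ≤ 19) (hD1 : 0 ≤ DD η₁)
    (hD2 : DD η₂ ≤ 0) {η : ℝ} (hη : 0 < η) : PD η ≤ PD η₁ + DD η₁ * (η₂ - η₁) := by
  have cont : ∀ a b : ℝ, 0 < a → ContinuousOn PD (Icc a b) := fun a b ha =>
    (continuousOn_profileD1 (15 / 2)).mono fun x hx => lt_of_lt_of_le ha hx.1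
  have diff : ∀ a b : ℝ, 0 < a → DifferentiableOn ℝ PD (interior (Icc a b)) :=
    fun a b ha x hx => by
      rw [interior_Icc] at hx
      exact (hasDerivAt_PD (ha.trans hx.1)).differentiableAt.differentiableWithinAt
  have der : ∀ x : ℝ, 0 < x → deriv PD x = DD x := fun x hx => (hasDerivAt_PD hx).deriv
  have h2pos : 0 < η₂ := h1.trans_le h12
  -- the tangent bound on `[η₁, y]` for `y ≤ η₂`
  have mid : ∀ y : ℝ, η₁ ≤ y → y ≤ η₂ → PD y - PD η₁ ≤ DD η₁ * (y - η₁) :=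
    fun y hy1 hy2 =>
    (convex_Icc η₁ y).image_sub_le_mul_sub_of_deriv_le (cont η₁ y h1) (diff η₁ y h1)
      (C := DD η₁)
      (fun x hx => by
        rw [interior_Icc] at hx
        rw [der x (h1.trans hx.1)]
        exact DD_antitoneOn h1 hx.1.le (by linarith [hx.2]))
      η₁ ⟨le_rfl, hy1⟩ y ⟨hy1, le_rfl⟩ hy1
  rcases le_total η η₁ with hle | hge
  · have mono : MonotoneOn PD (Icc η η₁) :=
      monotoneOn_of_deriv_nonneg (convex_Icc η η₁) (cont η η₁ hη) (diff η η₁ hη) fun x hx => by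
        rw [interior_Icc] at hx
        rw [der x (hη.trans hx.1)]
        exact hD1.trans (DD_antitoneOn (hη.trans hx.1) hx.2.le (h12.trans h2))
    have := mono ⟨le_rfl, hle⟩ ⟨hle, le_rfl⟩ hle
    nlinarith [mul_nonneg hD1 (sub_nonneg.2 h12)]
  · rcases le_total η η₂ with hle2 | hge2
    · have := mid η hge hle2
      nlinarith [mul_le_mul_of_nonneg_left (by linarith : η - η₁ ≤ η₂ - η₁) hD1]
    · have anti : AntitoneOn PD (Icc η₂ η) :=
        antitoneOn_of_deriv_nonpos (convex_Icc η₂ η) (cont η₂ η h2pos) (diff η₂ η h2pos)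
          fun x hx => by
            rw [interior_Icc] at hx
            rw [der x (h2pos.trans hx.1)]
            rcases le_or_gt x 19 with hx13 | hx13
            · exact (DD_antitoneOn h2pos hx.1.le hx13).trans hD2
            · exact (DD_neg_of_ge hx13.le).le
      have hA := anti ⟨le_rfl, hge2⟩ ⟨hge2, le_rfl⟩ hge2
      have := mid η₂ h12 le_rfl
      linarith

end Summit.KontsevichZagierPeriods.Zeta5Search.TwoTaleD1LineProfileShape

end
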